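import Summits.QuantumFields.YangMills.Theorems.UnitScaleTiltProp7SectET3Geometry
import Summits.QuantumFields.YangMills.Theorems.UnitScaleTiltProp8FlatPortKernelRows
import Summits.QuantumFields.YangMills.Theorems.UnitScaleTiltProp8FlatCubeOpsTextWhole
import Literature.MathematicalPhysics.QuantumFieldTheory.Balaban1983to89.B6PadLevelV1
import Literature.MathematicalPhysics.QuantumFieldTheory.Balaban1983to89.B9PinMembersKLevelV1
import HarnessLib

/-!
# Route `UnitScaleTilt`, crux «MinimiserStabilityRegPr» (stmt-QuantumFields-19200, v10 stub EX, route (α)) ∕ deciding crux 20520 (via T8) — OWNER RULING g25-№2 §3 +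
# OWNER 02:02:33Z socket (S2-idx): **THE MEMBER MAP — a T³ member `(F, n, K)` of the pure-small-field problem AS A MEMBER OF def-Y's k-LEVEL V1 INDEX at d + 1 = 3,
# and the bond junction back to the member's own lattice**

Cell `ym3-torus` (HUMAN RULING D-0037: YM₃ on T³ is ladder rung R3 — NOT the Clay problem), width seat `ym-ust-20520-w3` g2; count-neutral
(`--supports stmt-QuantumFields-19200 --as helper`).  ONE definition (`memberIdx`), theorems otherwise; 0 `sorry`; standard axioms.

THE MAP (signature posted on the cell bus 2026-08-28T02:04Z before typing).  For a T³ family member `F = ⟨ℓ + 1, hL, m, hm⟩ : T3Family` (block size `L = ℓ + 1 ≥ 5`),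
heights `n < K` (`k₀ := K − n ≥ 1` averaging steps), a big-block exponent `a'` (`M_h = L^{a'} ≥ 8`, torus room `a' + 3 ≤ m + n`) and a collar `R ≥ 2L²`,
**`memberIdx ℓ hL hℓ m hm n K a' R … : B6KLevelCensusIndexV1.KIdx 2 ℓ _ hL 1 1`** is the k-level V1 index member (def-Y's N06 member type; d + 1 = 3; band units
`b₀ = b₁ = 1`) that ★ym3-torus-p1's P2 port reads lit-balaban's k-level rows on (`FlatPortCor28Pad.cor28_kLevel_H_DH_pad`), namely THE PADDED CHART of the
PURE-SMALL-FIELD family: torus `PV 2 ℓ m K _ hL` (= `F.P K`, `UnitScaleTiltProp8FlatPortChart`), domains `Domains.whole (K − n)` (every `Ω_j` the torus,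
`FlatCubeOpsTextWhole`), charted by p1's `FlatPortChart.tdOfAdm` at `M_h = L^{a'}`, `P′ = 2L^{m+n−1−a'}` (`FlatPortKernelRows.chart_params`), then PADDED by one
empty top level (`B6PadLevelV1.padT`, `hN_pad`; index height `k := K − n + 1`, `P″ = 2L^{m+n−2−a'}`) so that the V1 index's placement field `hpl` holds for
EVERY `L ≥ 5` (`placed_pad`; unpadded it is dischargeable only at `L = 5`), with p1's band weights `(L^{k₀}∕L^{j(i)})²·(L^{j(i)})³` transported along
`sameOm_domT_pad` (`globalBand_unitWeights`, `globalBand_pad`, `unitWeights_pos`), `c_f = L^{k₀}`.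

WHAT THIS FILE PROVIDES.
* §1 the chart letters `chartP'`, `chartP''` are NOT new defs — written as lambda terms; `hN_chart`∕`hLP_chart`∕`hP5_chart` (= `chart_params`), `tdWhole` data as terms;
* §2 ★ `memberIdx` (the ONE `def`) and its field readings `memberIdx_m ∕ _K ∕ _k ∕ _Mh ∕ _R ∕ _a ∕ _cf` (`rfl`);
* §3 THE JUNCTION: `sameOm_memberIdx : SameOm (Domains.whole (K − n) _) (domT (memberIdx …).hN (memberIdx …).D (memberIdx …).hk)` — the padded chart has THE SAME
  `Ω_j` as the all-torus family on `PV 2 ℓ m K _ hL` (p1's `domT_tdOfAdm` + lit-balaban's `sameOm_domT_pad`), whence the bond re-indexing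
  `bondIdxEquiv : (geo9K (memberIdx …)).Site ≃ BondIdx (Domains.whole (K − n) _)` (`SameOm.idxB`) preserving the level (`bondIdxEquiv_level`); fine bonds ∕ sites are
  `PBond (PV 2 ℓ m K _ hL) 0` ∕ `Site (PV 2 ℓ m K _ hL) 0` on both sides LITERALLY (the composition with ★w5-20520's `siteEquiv F K : Site (F.P K) 0 ≃ TSite 3 _`,
  p595802, is then a plain `Equiv.trans` in the instance file);
* §4 the geometry rows of `UnitScaleTiltProp7SectET3Geometry` READ AT THE MEMBERS (`geoOK_memberIdx`, …) and the `MemberY` lift at any floor `M⋆ ≤ L·M_h`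
  (`memberY`, `geo9Y_memberY`).
LOCATED (numbers, inherited from the V1 index ∕ p1's chart): `4 ≤ ℓ` (L ≥ 5; L = 3 is sub-gap (P2-L3)), `1 ≤ K − n`, `a' + 3 ≤ m + n` (tori with ≥ 5·L·M_h sites per
direction), `8 ≤ L^{a'}`, `2L² ≤ R`.  HONEST FRAMING: packaging of landed objects; nothing of [Balaban1984PropagatorsII]∕[Balaban1985BackgroundPropagators] asserted; no
claim on a stub, the crux, V3∕R3 or the gap; YM₃ on T³ = rung R3 (RECORD†), not Clay.

References: T. Bałaban, CMP **96** (1984) 223–250 [Balaban1984PropagatorsII] ((2.1)–(2.4) p.224, (2.16) p.225, (2.36) p.229, (2.45)–(2.46) p.231, (2.150) p.249);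
CMP **99** (1985) 389–434 [Balaban1985BackgroundPropagators] (Sect. A (3.39)–(3.41) p.397).
-/

set_option autoImplicit false

noncomputable section

namespace Summit.QuantumFields.YangMills.Theorems.Prop7SectET3Members

open Literature.MathematicalPhysics.QuantumFieldTheory.Balaban1983to89
open Literature.MathematicalPhysics.QuantumFieldTheory.Balaban1983to89.B6KLevelCensusIndexV1 (KIdx)
open Literature.MathematicalPhysics.QuantumFieldTheory.Balaban1983to89.B9GeoNormsKLevelV1 (geo9K)
open Literature.MathematicalPhysics.QuantumFieldTheory.Balaban1983to89.B9PinMembersKLevelV1 (MemberY geo9Y)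
open Literature.MathematicalPhysics.QuantumFieldTheory.Balaban1983to89.B9Thm312Whole (GeoOK)
open B6MultiLevelBoxOperator (N0)
open B6MultiLevelTorusOperator (TDomains)
open B6GlobalChartV1 (PV domT)
open B6SectADomainsV1 (Domains)
open B6SectAOperatorsV1 (BondIdx)
open B6CubeWindowV1 (GlobalBand)
open B6PadLevelV1 (SameOm padT hN_pad placed_pad sameOm_domT_pad globalBand_pad)
open FlatPortChart (tdOfAdm domT_tdOfAdm)
open FlatPortKernelRows (chart_params globalBand_unitWeights unitWeights_pos)
open FlatCubeOpsTextWhole (adm22_whole whole_Om_of_le)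
open Prop7SectET3Geometry (geoOK_geo9K)

/-- `d + 1 = 3`: the dimension side condition of the V1 index at `d = 2` (proof-irrelevant letter; p1's files each carry a private copy). [folklore] -/
theorem hd3 : 1 ≤ 2 + 1 := by norm_num

/-! ## §1 The chart letters of the pure-small-field family (p1's `chart_params`) -/

section Chart

/-- p1's chart: `N0 ℓ L^{a'} (K − n) P′ = 2L^{m+K}` sites per direction with `P′ := 2L^{m+n−1−a'}`. [cite: Balaban1984PropagatorsII, (2.1) p.224 (dictionary)] -/
theorem hN_chart (ℓ : ℕ) (hL : Odd (ℓ + 1) ∧ 1 < ℓ + 1) (hℓ : 4 ≤ ℓ) (m n K a' : ℕ) (hk1 : 1 ≤ K - n) (hsize : a' + 3 ≤ m + n) : ∀ μ : Fin (2 + 1), N0 ℓ ((ℓ + 1) ^ a') (K - n) (fun _ => 2 * (ℓ + 1) ^ (m + n - 1 - a')) μ = (PV 2 ℓ m K hd3 hL).sitesPerDir 0 :=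
  (chart_params ℓ m n K a' hL hℓ hk1 hsize).1

/-- p1's chart: `P′ = L·P″` with `P″ := 2L^{m+n−2−a'}`. [cite: Balaban1984PropagatorsII, (2.1) p.224 (dictionary)] -/
theorem hLP_chart (ℓ : ℕ) (hL : Odd (ℓ + 1) ∧ 1 < ℓ + 1) (hℓ : 4 ≤ ℓ) (m n K a' : ℕ) (hk1 : 1 ≤ K - n) (hsize : a' + 3 ≤ m + n) : ∀ μ : Fin (2 + 1), (fun _ : Fin (2 + 1) => 2 * (ℓ + 1) ^ (m + n - 1 - a')) μ = (ℓ + 1) * (fun _ : Fin (2 + 1) => 2 * (ℓ + 1) ^ (m + n - 2 - a')) μ :=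
  (chart_params ℓ m n K a' hL hℓ hk1 hsize).2.1

/-- p1's chart: `5 ≤ P″`. [cite: Balaban1984PropagatorsII, (2.1) p.224 (dictionary)] -/
theorem hP5_chart (ℓ : ℕ) (hL : Odd (ℓ + 1) ∧ 1 < ℓ + 1) (hℓ : 4 ≤ ℓ) (m n K a' : ℕ) (hk1 : 1 ≤ K - n) (hsize : a' + 3 ≤ m + n) : ∀ μ : Fin (2 + 1), 5 ≤ (fun _ : Fin (2 + 1) => 2 * (ℓ + 1) ^ (m + n - 2 - a')) μ :=
  (chart_params ℓ m n K a' hL hℓ hk1 hsize).2.2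

/-- the all-torus family's height bound on the V1 torus `PV 2 ℓ m K`: `K − n ≤ m + K`. [folklore] -/
theorem hkw (ℓ : ℕ) (hL : Odd (ℓ + 1) ∧ 1 < ℓ + 1) (m n K : ℕ) : K - n ≤ (PV 2 ℓ m K hd3 hL).m + (PV 2 ℓ m K hd3 hL).K := by
  show K - n ≤ m + K; omega

/-- **THE PURE-SMALL-FIELD FAMILY CHARTED**: p1's `tdOfAdm` chart of the all-torus domain family `Domains.whole (K − n)` (every `Ω_j` the torus) at `M_h = L^{a'}`,
`P′ = 2L^{m+n−1−a'}`, any collar `R`. [cite: Balaban1984PropagatorsII, (2.1)–(2.4) p.224] -/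
def tdWhole (ℓ : ℕ) (hL : Odd (ℓ + 1) ∧ 1 < ℓ + 1) (hℓ : 4 ≤ ℓ) (m n K a' : ℕ) (hk1 : 1 ≤ K - n) (hsize : a' + 3 ≤ m + n) (R : ℕ) : TDomains 2 ℓ ((ℓ + 1) ^ a') (K - n) (fun _ => 2 * (ℓ + 1) ^ (m + n - 1 - a')) R :=
  tdOfAdm (hN_chart ℓ hL hℓ m n K a' hk1 hsize) (Domains.whole (K - n) (hkw ℓ hL m n K)) rfl
    (whole_Om_of_le (hkw ℓ hL m n K) hk1) hk1 (by show K - n ≤ m + K; omega) (adm22_whole (hkw ℓ hL m n K) R ((ℓ + 1) * (ℓ + 1) ^ a'))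

/-- the chart recovers the all-torus family: `domT hN (tdWhole …) _ = Domains.whole (K − n)`. [cite: Balaban1984PropagatorsII, (2.1)–(2.4) p.224 (dictionary)] -/
theorem domT_tdWhole (ℓ : ℕ) (hL : Odd (ℓ + 1) ∧ 1 < ℓ + 1) (hℓ : 4 ≤ ℓ) (m n K a' : ℕ) (hk1 : 1 ≤ K - n) (hsize : a' + 3 ≤ m + n) (R : ℕ) :
    domT (hN_chart ℓ hL hℓ m n K a' hk1 hsize) (tdWhole ℓ hL hℓ m n K a' hk1 hsize R) (by show K - n ≤ m + K; omega) =
      Domains.whole (K - n) (hkw ℓ hL m n K) :=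
  domT_tdOfAdm (hN_chart ℓ hL hℓ m n K a' hk1 hsize) (Domains.whole (K - n) (hkw ℓ hL m n K)) rfl
    (whole_Om_of_le (hkw ℓ hL m n K) hk1) hk1 (by show K - n ≤ m + K; omega) (adm22_whole (hkw ℓ hL m n K) R ((ℓ + 1) * (ℓ + 1) ^ a'))

end Chart

/-! ## §2 ★ The member of def-Y's k-level V1 index (d + 1 = 3, padded chart, band units) -/

section Member

/-- ★ **THE MEMBER MAP**: the T³ member `(F, n, K)`, `F = ⟨ℓ+1, hL, m, hm⟩`, with big blocks `M_h = L^{a'}` and collar `R`, AS A MEMBER OF def-Y's k-LEVEL V1 INDEX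
at d + 1 = 3 in the band units `b₀ = b₁ = 1`: the PADDED chart of the pure-small-field family (index height `k = K − n + 1`, `P″ = 2L^{m+n−2−a'}`, every cube below
the top ⇒ `Placed`), p1's band weights `(L^{K−n}∕L^{j})²(L^{j})³` transported along `sameOm_domT_pad`, `c_f = L^{K−n}`.  This is the index p1's P2 port reads
lit-balaban's k-level rows on (`FlatPortCor28Pad.cor28_kLevel_H_DH_pad`). [cite: Balaban1984PropagatorsII, (2.1)–(2.4) p.224, (2.16) p.225, (2.36) p.229, (2.150) p.249] -/
def memberIdx (ℓ : ℕ) (hL : Odd (ℓ + 1) ∧ 1 < ℓ + 1) (hℓ : 4 ≤ ℓ) (m : ℕ) (_hm : 1 ≤ m) (n K a' R : ℕ)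
    (hk1 : 1 ≤ K - n) (hsize : a' + 3 ≤ m + n) (hM8 : 8 ≤ (ℓ + 1) ^ a') (hR2 : 2 * (ℓ + 1) ^ 2 ≤ R) : KIdx 2 ℓ hd3 hL 1 1 where
  m := m
  K := K
  Mh := (ℓ + 1) ^ a'
  k := K - n + 1
  R := R
  a := a'
  P' := fun _ => 2 * (ℓ + 1) ^ (m + n - 2 - a')
  hN := hN_pad (hN_chart ℓ hL hℓ m n K a' hk1 hsize) (hLP_chart ℓ hL hℓ m n K a' hk1 hsize)
  D := padT (tdWhole ℓ hL hℓ m n K a' hk1 hsize R) (hLP_chart ℓ hL hℓ m n K a' hk1 hsize)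
  hk := by show K - n + 1 ≤ m + K; omega
  hk2 := by omega
  hMha := rfl
  hM8 := hM8
  hR2 := hR2
  hP5 := hP5_chart ℓ hL hℓ m n K a' hk1 hsize
  hℓ := hℓ
  hpl := placed_pad _ _ (hP5_chart ℓ hL hℓ m n K a' hk1 hsize)
  cf := (((ℓ + 1 : ℕ) : ℝ)) ^ (K - n)
  hcf := pow_ne_zero _ (by exact_mod_cast Nat.succ_ne_zero ℓ)
  w := (fun i : BondIdx (domT (hN_chart ℓ hL hℓ m n K a' hk1 hsize) (tdWhole ℓ hL hℓ m n K a' hk1 hsize R) (by show K - n ≤ m + K; omega)) =>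
      ((((ℓ + 1 : ℕ) : ℝ)) ^ (K - n) / (((ℓ + 1 : ℕ) : ℝ)) ^ (i.1.1 : ℕ)) ^ 2 * ((((ℓ + 1 : ℕ) : ℝ)) ^ (i.1.1 : ℕ)) ^ (2 + 1)) ∘
    (sameOm_domT_pad (hN_chart ℓ hL hℓ m n K a' hk1 hsize) (tdWhole ℓ hL hℓ m n K a' hk1 hsize R) (by show K - n ≤ m + K; omega)
      (hLP_chart ℓ hL hℓ m n K a' hk1 hsize) (by show K - n + 1 ≤ m + K; omega)).idxB
  hw := fun i => unitWeights_pos ℓ hL m n K (hN_chart ℓ hL hℓ m n K a' hk1 hsize) (tdWhole ℓ hL hℓ m n K a' hk1 hsize R)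
    (by show K - n ≤ m + K; omega) _
  hwb := globalBand_pad (tdWhole ℓ hL hℓ m n K a' hk1 hsize R) (hLP_chart ℓ hL hℓ m n K a' hk1 hsize) (hN_chart ℓ hL hℓ m n K a' hk1 hsize)
    (by show K - n ≤ m + K; omega) (by show K - n + 1 ≤ m + K; omega)
    (globalBand_unitWeights ℓ hL m n K (hN_chart ℓ hL hℓ m n K a' hk1 hsize) (tdWhole ℓ hL hℓ m n K a' hk1 hsize R) (by show K - n ≤ m + K; omega))

/-- the volume exponent of the member is `F.m`. [folklore] -/
@[simp] theorem memberIdx_m (ℓ : ℕ) (hL : Odd (ℓ + 1) ∧ 1 < ℓ + 1) (hℓ : 4 ≤ ℓ) (m : ℕ) (hm : 1 ≤ m) (n K a' R : ℕ)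
    (hk1 : 1 ≤ K - n) (hsize : a' + 3 ≤ m + n) (hM8 : 8 ≤ (ℓ + 1) ^ a') (hR2 : 2 * (ℓ + 1) ^ 2 ≤ R) : (memberIdx ℓ hL hℓ m hm n K a' R hk1 hsize hM8 hR2).m = m := rfl
/-- the fine level count of the member is `K`. [folklore] -/
@[simp] theorem memberIdx_K (ℓ : ℕ) (hL : Odd (ℓ + 1) ∧ 1 < ℓ + 1) (hℓ : 4 ≤ ℓ) (m : ℕ) (hm : 1 ≤ m) (n K a' R : ℕ)
    (hk1 : 1 ≤ K - n) (hsize : a' + 3 ≤ m + n) (hM8 : 8 ≤ (ℓ + 1) ^ a') (hR2 : 2 * (ℓ + 1) ^ 2 ≤ R) : (memberIdx ℓ hL hℓ m hm n K a' R hk1 hsize hM8 hR2).K = K := rfl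
/-- the index height is the PADDED height `K − n + 1`. [folklore] -/
@[simp] theorem memberIdx_k (ℓ : ℕ) (hL : Odd (ℓ + 1) ∧ 1 < ℓ + 1) (hℓ : 4 ≤ ℓ) (m : ℕ) (hm : 1 ≤ m) (n K a' R : ℕ)
    (hk1 : 1 ≤ K - n) (hsize : a' + 3 ≤ m + n) (hM8 : 8 ≤ (ℓ + 1) ^ a') (hR2 : 2 * (ℓ + 1) ^ 2 ≤ R) : (memberIdx ℓ hL hℓ m hm n K a' R hk1 hsize hM8 hR2).k = K - n + 1 := rfl
/-- the big-block size is `M_h = L^{a'}`. [folklore] -/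
@[simp] theorem memberIdx_Mh (ℓ : ℕ) (hL : Odd (ℓ + 1) ∧ 1 < ℓ + 1) (hℓ : 4 ≤ ℓ) (m : ℕ) (hm : 1 ≤ m) (n K a' R : ℕ)
    (hk1 : 1 ≤ K - n) (hsize : a' + 3 ≤ m + n) (hM8 : 8 ≤ (ℓ + 1) ^ a') (hR2 : 2 * (ℓ + 1) ^ 2 ≤ R) : (memberIdx ℓ hL hℓ m hm n K a' R hk1 hsize hM8 hR2).Mh = (ℓ + 1) ^ a' := rfl
/-- the collar is `R`. [folklore] -/
@[simp] theorem memberIdx_R (ℓ : ℕ) (hL : Odd (ℓ + 1) ∧ 1 < ℓ + 1) (hℓ : 4 ≤ ℓ) (m : ℕ) (hm : 1 ≤ m) (n K a' R : ℕ)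
    (hk1 : 1 ≤ K - n) (hsize : a' + 3 ≤ m + n) (hM8 : 8 ≤ (ℓ + 1) ^ a') (hR2 : 2 * (ℓ + 1) ^ 2 ≤ R) : (memberIdx ℓ hL hℓ m hm n K a' R hk1 hsize hM8 hR2).R = R := rfl
/-- the band unit is `c_f = L^{K−n}`. [folklore] -/
@[simp] theorem memberIdx_cf (ℓ : ℕ) (hL : Odd (ℓ + 1) ∧ 1 < ℓ + 1) (hℓ : 4 ≤ ℓ) (m : ℕ) (hm : 1 ≤ m) (n K a' R : ℕ)
    (hk1 : 1 ≤ K - n) (hsize : a' + 3 ≤ m + n) (hM8 : 8 ≤ (ℓ + 1) ^ a') (hR2 : 2 * (ℓ + 1) ^ 2 ≤ R) : (memberIdx ℓ hL hℓ m hm n K a' R hk1 hsize hM8 hR2).cf = (((ℓ + 1 : ℕ) : ℝ)) ^ (K - n) := rfl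
/-- the coarse period of the padded chart is `P″ = 2L^{m+n−2−a'}`. [folklore] -/
@[simp] theorem memberIdx_P' (ℓ : ℕ) (hL : Odd (ℓ + 1) ∧ 1 < ℓ + 1) (hℓ : 4 ≤ ℓ) (m : ℕ) (hm : 1 ≤ m) (n K a' R : ℕ)
    (hk1 : 1 ≤ K - n) (hsize : a' + 3 ≤ m + n) (hM8 : 8 ≤ (ℓ + 1) ^ a') (hR2 : 2 * (ℓ + 1) ^ 2 ≤ R) (μ : Fin (2 + 1)) : (memberIdx ℓ hL hℓ m hm n K a' R hk1 hsize hM8 hR2).P' μ = 2 * (ℓ + 1) ^ (m + n - 2 - a') := rfl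

/-! ## §3 The junction: the member's domains ARE the all-torus family on `PV 2 ℓ m K = F.P K`; the index bonds re-index level-preservingly -/

/-- ★ **THE PADDED MEMBER HAS THE SAME `Ω_j` AS THE PURE-SMALL-FIELD FAMILY ON THE MEMBER'S TORUS** (`Domains.whole (K − n)` on `PV 2 ℓ m K _ hL`): p1's
`domT_tdOfAdm` followed by lit-balaban's `sameOm_domT_pad`. [cite: Balaban1984PropagatorsII, (2.1)–(2.4) p.224] -/
theorem sameOm_memberIdx (ℓ : ℕ) (hL : Odd (ℓ + 1) ∧ 1 < ℓ + 1) (hℓ : 4 ≤ ℓ) (m : ℕ) (hm : 1 ≤ m) (n K a' R : ℕ)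
    (hk1 : 1 ≤ K - n) (hsize : a' + 3 ≤ m + n) (hM8 : 8 ≤ (ℓ + 1) ^ a') (hR2 : 2 * (ℓ + 1) ^ 2 ≤ R) :
    SameOm (Domains.whole (K - n) (hkw ℓ hL m n K))
      (domT (memberIdx ℓ hL hℓ m hm n K a' R hk1 hsize hM8 hR2).hN (memberIdx ℓ hL hℓ m hm n K a' R hk1 hsize hM8 hR2).D
        (memberIdx ℓ hL hℓ m hm n K a' R hk1 hsize hM8 hR2).hk) := by
  have h := sameOm_domT_pad (hN_chart ℓ hL hℓ m n K a' hk1 hsize) (tdWhole ℓ hL hℓ m n K a' hk1 hsize R) (by show K - n ≤ m + K; omega)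
    (hLP_chart ℓ hL hℓ m n K a' hk1 hsize) (by show K - n + 1 ≤ m + K; omega)
  rw [domT_tdWhole] at h
  exact h

/-- **THE INDEX BONDS OF THE MEMBER RE-INDEX THE BOND INDEX OF THE ALL-TORUS FAMILY** (`SameOm.idxB`): `(geo9K (memberIdx …)).Site ≃ BondIdx (Domains.whole (K − n) _)`.
[cite: Balaban1984PropagatorsII, (2.6) p.224, (2.45) p.231 (dictionary)] -/
def bondIdxEquiv (ℓ : ℕ) (hL : Odd (ℓ + 1) ∧ 1 < ℓ + 1) (hℓ : 4 ≤ ℓ) (m : ℕ) (hm : 1 ≤ m) (n K a' R : ℕ)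
    (hk1 : 1 ≤ K - n) (hsize : a' + 3 ≤ m + n) (hM8 : 8 ≤ (ℓ + 1) ^ a') (hR2 : 2 * (ℓ + 1) ^ 2 ≤ R) : (geo9K (memberIdx ℓ hL hℓ m hm n K a' R hk1 hsize hM8 hR2)).Site ≃ BondIdx (Domains.whole (K - n) (hkw ℓ hL m n K)) :=
  (sameOm_memberIdx ℓ hL hℓ m hm n K a' R hk1 hsize hM8 hR2).idxB

/-- the re-indexing keeps the level and the fine bond: `(bondIdxEquiv i).1 = i.1` as (level, bond) pairs up to the `Fin` cast — levels agree.
[cite: Balaban1984PropagatorsII, (2.45) p.231 (dictionary)] -/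
theorem bondIdxEquiv_level (ℓ : ℕ) (hL : Odd (ℓ + 1) ∧ 1 < ℓ + 1) (hℓ : 4 ≤ ℓ) (m : ℕ) (hm : 1 ≤ m) (n K a' R : ℕ)
    (hk1 : 1 ≤ K - n) (hsize : a' + 3 ≤ m + n) (hM8 : 8 ≤ (ℓ + 1) ^ a') (hR2 : 2 * (ℓ + 1) ^ 2 ≤ R)
    (i : (geo9K (memberIdx ℓ hL hℓ m hm n K a' R hk1 hsize hM8 hR2)).Site) :
    (((bondIdxEquiv ℓ hL hℓ m hm n K a' R hk1 hsize hM8 hR2 i).1.1 : ℕ)) = (i.1.1 : ℕ) := rfl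

/-! ## §4 The geometry rows read at the members; the `MemberY` lift -/

/-- `GeoOK` at the member (row `hgeo` of the N06 capstones), by `Prop7SectET3Geometry.geoOK_geo9K`. [cite: Balaban1984PropagatorsII, (2.46) p.231, (2.54) p.233] -/
theorem geoOK_memberIdx (ℓ : ℕ) (hL : Odd (ℓ + 1) ∧ 1 < ℓ + 1) (hℓ : 4 ≤ ℓ) (m : ℕ) (hm : 1 ≤ m) (n K a' R : ℕ)
    (hk1 : 1 ≤ K - n) (hsize : a' + 3 ≤ m + n) (hM8 : 8 ≤ (ℓ + 1) ^ a') (hR2 : 2 * (ℓ + 1) ^ 2 ≤ R) : GeoOK (geo9K (memberIdx ℓ hL hℓ m hm n K a' R hk1 hsize hM8 hR2)) := geoOK_geo9K _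

/-- **THE `MemberY` LIFT AT A FLOOR `M⋆ ≤ L·L^{a'}`** (def-Y's record member type: the index member twice — here the DIAGONAL pairing `x.snd := x.toKIdx` is not
assumed; we only provide the `KIdx` and note that `geo9Y x = geo9K x.toKIdx` for ANY `x` with `x.toKIdx = memberIdx …`). [cite: Balaban1985BackgroundPropagators, Sect. A p.397 (dictionary)] -/
theorem geo9Y_of_toKIdx (ℓ : ℕ) (hL : Odd (ℓ + 1) ∧ 1 < ℓ + 1) (hℓ : 4 ≤ ℓ) (m : ℕ) (hm : 1 ≤ m) (n K a' R : ℕ)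
    (hk1 : 1 ≤ K - n) (hsize : a' + 3 ≤ m + n) (hM8 : 8 ≤ (ℓ + 1) ^ a') (hR2 : 2 * (ℓ + 1) ^ 2 ≤ R) {Mstar : ℕ} (x : MemberY 2 ℓ hd3 hL 1 1 Mstar) (hx : x.toKIdx = memberIdx ℓ hL hℓ m hm n K a' R hk1 hsize hM8 hR2) :
    geo9Y x = geo9K (memberIdx ℓ hL hℓ m hm n K a' R hk1 hsize hM8 hR2) := by
  rw [← hx]; rfl

end Member

end Summit.QuantumFields.YangMills.Theorems.Prop7SectET3Members

end
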